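import Literature.Barriers.CriticalPhenomena.SupercriticalSAWSpaceFillingTuned
import Mathlib.Analysis.Convex.SpecificFunctions.Basic
import Mathlib.Analysis.Convex.Jensen
import HarnessLib

/-!
# Barrier mechanism, tenth audit: the DENSITY / FREE-ENERGY axis — one-sided information DOES
# cross `x_c` for scalar observables monotone or convex in the fugacity; the supercritical
# free-energy increment is the cumulant generating function of the CRITICAL length

Barrier catalogue `Literature/Barriers/CriticalPhenomena/` (D-0021); tenth audit (2026-08-16,
refuter, "barrier-audit" gen 10) of the mechanism file `…Proofs` of
`SupercriticalSAWSpaceFilling` = Theorem 1 of H. Duminil-Copin, G. Kozma, A. Yadin,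
*Supercritical self-avoiding walks are space-filling*, Ann. IHP Probab. Stat. 50 (2014) 315–326,
arXiv:1110.3074 — PROVED in the tree (`SupercriticalSAWSpaceFilling_holds`), `blocks:` clause
unconditional (`SupercriticalSAW.not_robustSAWScalingLimit`). Gens 1–9 narrowed the technique
class along the fugacity-window, trace/prefix, closedness, onto-iff, subcritical, phase, length,
left-robust and reversibility axes, always for conclusions about the LAW of the walk, and the
catalogue entry still reads `evasions_known: none published for transferring information across
x_c`. Outcome of this audit: **parent barrier confirmed at page level; NARROWED on a new axis —
scalar thermodynamic observables — where transfer across `x_c` is not only possible but an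
identity.**

## What the audit found

1. **Page level (confirming).** Theorem 1 (p. 2), Theorem 2 (p. 3, microscopically expanded
   domains) and §4 (p. 8) of the source are as vendored; §4 adds, before Problem 9: "We know that
   the curve becomes space-filling, yet we have very little additional information. … It is not
   difficult to show that the length is of order `1/δ²`, yet a sharper result would be
   interesting: **Problem 9.** For `x > 1/μ`, show that there exists `θ(x) > 0` such that …
   `P_{(Ω_δ,a_δ,b_δ,x)}(| |γ_δ| - θ(x)·|Ω_δ| | > ε|Ω_δ|) → 0` … The quantity `θ(x)` would thus
   be an averaged density of the walk", and "Another challenge is to try to say something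
   nontrivial about the critical phase … **Problem 10.**" Forward citations re-checked (27; 4
   since 2022, newest Ann. Probab. 54 (2026), arXiv:2310.17299): none evades the barrier, none
   treats the supercritical density.
2. **The gap.** Every obstruction in the catalogue is of the form "an `x`-robust description of
   the law fails at `x ≠ x_c`". For SCALAR observables that are monotone or convex in `x` the
   situation is the opposite: at every FIXED mesh, (a) the mean length
   `E_{(𝔻_δ,u,v,x)}|γ| = x (log Z_δ)'(x)` is nondecreasing in `x` (`meanLength_mono`: the family
   `x^{|γ|}` has monotone likelihood ratio in `|γ|`), so `E_{x_c}|γ_δ| ≤ E_x|γ_δ|` for all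
   `x > x_c` (`meanLength_criticalFugacity_le`); (b) `log Z_δ` is convex in `log x`, whence the
   two Jensen inequalities `E_{x_c}|γ_δ| log(x/x_c) ≤ log Z_δ(x) - log Z_δ(x_c) ≤ E_x|γ_δ| log(x/x_c)`
   (`meanLength_mul_log_le`, `log_Zfin_sub_log_Zfin_mem`); (c) the supercritical partition
   function RELATIVE to the critical one is the moment generating function of the critical
   length, `Z_δ(x)/Z_δ(x_c) = E_{(𝔻_δ,a_δ,b_δ,x_c)}[(x/x_c)^{|γ_δ|}]`, so Chebyshev bounds the upper
   tail of the CRITICAL length by supercritical free energies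
   (`lawAt_setOf_le_length_le_Zfin_div`) and, conversely, the split of this expectation at a
   density threshold bounds supercritical free energies by critical tails (`Zfin_mul_le`, with
   the maximal length `|γ_δ| ≤ |𝔻_δ| ≤ 25/δ²`, `length_le_div_sq`).
3. **The transfer theorems (proved, unit disc, any endpoints in `𝔻_δ`).** Writing
   (Θ) "`∀ ρ > 0 ∃ x > x_c`: `δ² E_{(𝔻_δ,a_δ,b_δ,x)}|γ_δ| ≤ ρ` for all small `δ`" — right-continuity
   at `x_c` of the supercritical density, the `θ(x)` of Problem 9 in finite-volume form;
   (F) "`∀ ε > 0 ∃ x > x_c`: `δ² (log Z_δ(x) - log Z_δ(x_c)) ≤ ε log(x/x_c)` for all small `δ`" —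
   flatness of the free-energy increment at `x_c⁺`;
   (LD) "`∀ ρ > 0 ∃ c > 0`: `P_{(𝔻_δ,a_δ,b_δ,x_c)}[δ²|γ_δ| ≥ ρ] ≤ e^{-c/δ²}` for all small `δ`" —
   exponential rarity of dense configurations under the CRITICAL law;
   (Z) "`P_{x_c}[δ²|γ_δ| ≥ ρ] → 0` for every `ρ > 0`" — zero critical density:
   **(Θ) ⟺ (F)** (`flat_of_densityRightContinuous`, `densityRightContinuous_of_flat`),
   **(F) ⟺ (LD)** (`expRare_of_flat`, `flat_of_expRare`), **(Θ) ⟹ `δ² E_{x_c}|γ_δ| → 0` ⟹ (Z)**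
   (`tendsto_sq_mul_meanLength_criticalFugacity`, `tendsto_lawAt_density_of_tendsto_meanLength`).
   So a statement about the supercritical walks AS `x ↓ x_c` (continuity of the dilute/dense
   transition, i.e. of Problem 9's `θ`) yields a statement about the critical phase — the
   "from the supercritical side" twin of the left-uniform route (xii) of `…LeftRobust`. Zero
   critical density is NECESSARY for `SAWScalingLimit` in the disc (a limit in law in the curve
   topology carried by curves of zero area forces `|γ_δ|δ² → 0` in probability: the `δ`-squares
   around the visited sites are disjoint and lie in the `δ`-neighbourhood of the trace, and the
   SLE_{8/3} trace has zero area by the one-point estimate, Rohde–Schramm Thm 8.1; proved in the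
   part-B companion `…DensityNecessary`, `tendsto_law_density_of_sawScalingLimit`) and is logically independent of Problem 10 (weak space-filling needs only
   `≍ δ⁻¹/ε` sites; positive density does not fill every open set).
4. **Status in print; where the difficulty goes.** In the square-crossing geometry the free
   energy `𝓗(z) = lim n⁻² log ς_n(z)` exists for every `z` (Janse van Rensburg, Thm 5.74,
   p. 215 of the 2015 monograph), is `0` for `z ≤ 1/μ` and `> 0` for `z > 1/μ` (Thm 5.77,
   Cor. 5.78, p. 219, after Madras 1995 and Whittington–Guttmann 1990); `𝓗(e^s)` is convex, so
   there (F) reads `𝓗'(z_c⁺) = 0` — continuity of the dilute/dense transition, expected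
   (heuristically, hyperscaling with `ν = 3/4`) with `𝓗 ≍ (z - z_c)^{3/2}`, but unproved: the
   only rigorous upper bound near `z_c` is the linear one from `|γ| ≤ |Ω_δ|`. (LD) follows from
   the exponential rarity of positive-density confinement of FREE self-avoiding walks
   ("`I(ρ) > 0` for every `ρ > 0`"), a counting exercise at densities close to the maximal one
   (2-factor / permanent bounds) and open as `ρ → 0` — in the spirit of the missing lower bounds
   on the displacement exponent ("it is still an open question to prove that this 'obvious'
   inequality `⟨|ω(N)|²⟩ ≥ CN` holds", Madras–Slade §1.1, p. 6; sub-ballisticity is the known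
   upper side, Duminil-Copin–Hammond 2013). The axis therefore RELOCATES the difficulty of the
   critical phase into a counting problem about dense polymers near `x_c`; it does not remove
   it. What it refutes is the catalogue's blanket "no transfer across `x_c`".

## Formal content (all proved; one new closed `Prop`, `SupercriticalSAWSpaceFillingDensity`)

Sums: `Zfin`, `Lfin`, `meanLength` (`finsum`s; `_eq_sum`, `_nonneg`), `Zfin_mono`,
`sub_mul_pow_sub_nonneg`, `Lfin_mul_Zfin_le`, `meanLength_mono`, `meanLength_mul_log_le`
(Jensen), `sum_filter_le_length_le` (Markov), `sum_filter_mul_rpow_le` (Chebyshev); disc: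
`Zfin_pos`, `finite_meshDomain_unitDisk`, `length_le_div_sq`, `setOf_density_eq`,
`lawAt_setOf_le_length_eq`, `lawAt_setOf_le_length_le_meanLength_div`, `lawAt_density_le`,
`lawAt_setOf_le_length_le_Zfin_div`, `Zfin_mul_le`; transfer: `eventually_pos_and_le_one`,
`meanLength_criticalFugacity_le`, `log_Zfin_sub_log_Zfin_mem`, `expRare_of_flat`,
`flat_of_expRare`, `densityRightContinuous_of_flat`, `flat_of_densityRightContinuous`,
`tendsto_sq_mul_meanLength_criticalFugacity`, `tendsto_lawAt_density_of_tendsto_meanLength`;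
the closed `Prop` `SupercriticalSAWSpaceFillingDensity` and `SupercriticalSAWSpaceFillingDensity_holds`.

Mathlib: `ConvexOn.map_sum_le` with `convexOn_exp` (Jensen), `Real.exp_nat_mul`,
`Real.rpow_le_rpow_of_exponent_le`, `Real.rpow_def_of_pos`, `Real.log_rpow`, `Real.log_sqrt`,
`Real.lt_sqrt`, `Finset.sum_comm`, `Finset.sum_mul_sum`, `Finset.sum_filter_add_sum_filter_not`,
`finsum_eq_sum_of_fintype`, `finsum_nonneg`, `ENNReal.toReal_le_of_le_ofReal`,
`ENNReal.tendsto_ofReal`, `tendsto_of_tendsto_of_tendsto_of_le_of_le'`, `tendsto_order`.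

## References (page-level; pages of the arXiv version for the source, of the book otherwise)

* H. Duminil-Copin, G. Kozma, A. Yadin, Ann. IHP Probab. Stat. 50 (2014) 315–326,
  arXiv:1110.3074: p. 2 (§1, `P_{(Ω_δ,a_δ,b_δ,x)}`, `Z_{(Ω_δ,a_δ,b_δ)}(x)`; Theorem 1), p. 3
  (Theorem 2), p. 8 (§4: "It is not difficult to show that the length is of order `1/δ²`";
  Problem 9, the density `θ(x)`; Problem 10; Conjecture 11). [DuminilCopinKozmaYadin2014]
* E. J. Janse van Rensburg, *The Statistical Mechanics of Interacting Walks, Polygons, Animals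
  and Vesicles*, 2nd ed., OUP (2015), §5.6.1: Thm 5.74 (p. 215: the limits
  `𝓕_ς(z) = lim n⁻¹ log ς_n(z)`, `𝓗_ς(z) = lim n⁻² log ς_n(z)` exist), Thm 5.77 and Cor. 5.78
  (p. 219: `𝓗_ς(z) > 0` for `z > 1/μ`, `z_c = 1/μ`; "It is also known that `𝓕_ς(z_c) = 0`").
  [Jansevanrensburg2015] [Madras1995] [WhittingtonGuttmann1990]
* N. Madras, G. Slade, *The Self-Avoiding Walk* (1993), §1.1, p. 6 ("it is still an open
  question to prove that … `⟨|ω(N)|²⟩ ≥ CN`"). [MadrasSlade1993]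
* H. Duminil-Copin, A. Hammond, *Self-avoiding walk is sub-ballistic*, Comm. Math. Phys. 324
  (2013) 401–423. [DuminilCopinHammond2013]
* G. F. Lawler, O. Schramm, W. Werner, *On the scaling limit of planar self-avoiding walk*
  (2004), arXiv:math/0204277, p. 17, Prediction 2 (`ν = 3/4`). [LawlerSchrammWerner2004SAW]
* S. Rohde, O. Schramm, *Basic properties of SLE*, Ann. Math. 161 (2005), Thm 8.1 (one-point
  estimate; zero area of the trace for `κ < 8`). [RohdeSchramm2005]
-/

noncomputable section

open MeasureTheory Filter Topology Literature.Probability.LatticeModels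
  Literature.Probability.Percolation Literature.Probability.RandomPlanarGeometry
  Literature.Probability.RandomPlanarGeometry.SAW
open scoped ENNReal NNReal

namespace Literature.Barriers.CriticalPhenomena

namespace SupercriticalSAW

variable {δ : ℝ} {u v : Site 2}

/-! ### Partition function, length-weighted sum and mean length as finite sums -/

/-- The partition function `Z_{(𝔻_δ,u,v)}(x) = Σ_γ x^{|γ|}` of self-avoiding walks of `𝔻_δ`
from `u` to `v`, as a real number (`finsum`; a finite sum for `δ > 0`, `u ∈ 𝔻_δ`).
[cite: DuminilCopinKozmaYadin2014, §1 (definition of P_{(Ω_δ,a_δ,b_δ,x)})] -/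
def Zfin (x δ : ℝ) (u v : Site 2) : ℝ :=
  ∑ᶠ γ : DomainSAW unitDisk δ u v, x ^ γ.length

/-- The length-weighted sum `Σ_γ |γ| x^{|γ|}` (`= x Z'(x)`). [folklore] -/
def Lfin (x δ : ℝ) (u v : Site 2) : ℝ :=
  ∑ᶠ γ : DomainSAW unitDisk δ u v, (γ.length : ℝ) * x ^ γ.length

/-- **The mean length** `E_{(𝔻_δ,u,v,x)}|γ| = Σ_γ |γ| x^{|γ|} / Σ_γ x^{|γ|}` of the self-avoiding
walk with parameter `x` (`= x (log Z)'(x)`); `δ² ·` this is the expected DENSITY of the walk, the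
finite-volume form of the `θ(x)` of Problem 9 of the source.
[cite: DuminilCopinKozmaYadin2014, §4 (Problem 9)] -/
def meanLength (x δ : ℝ) (u v : Site 2) : ℝ :=
  Lfin x δ u v / Zfin x δ u v

/-- `Z(x) ≥ 0` for `x ≥ 0`. [folklore] -/
theorem Zfin_nonneg {x : ℝ} (hx : 0 ≤ x) : 0 ≤ Zfin x δ u v :=
  finsum_nonneg fun _ => pow_nonneg hx _

/-- `Σ |γ| x^{|γ|} ≥ 0` for `x ≥ 0`. [folklore] -/
theorem Lfin_nonneg {x : ℝ} (hx : 0 ≤ x) : 0 ≤ Lfin x δ u v :=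
  finsum_nonneg fun _ => mul_nonneg (Nat.cast_nonneg _) (pow_nonneg hx _)

/-- `E_x|γ| ≥ 0` for `x ≥ 0`. [folklore] -/
theorem meanLength_nonneg {x : ℝ} (hx : 0 ≤ x) : 0 ≤ meanLength x δ u v :=
  div_nonneg (Lfin_nonneg hx) (Zfin_nonneg hx)

section Sums

variable [Fintype (DomainSAW unitDisk δ u v)]

/-- `Z` as a `Finset` sum. [folklore] -/
theorem Zfin_eq_sum (x : ℝ) : Zfin x δ u v = ∑ γ : DomainSAW unitDisk δ u v, x ^ γ.length :=
  finsum_eq_sum_of_fintype _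

/-- `Σ |γ| x^{|γ|}` as a `Finset` sum. [folklore] -/
theorem Lfin_eq_sum (x : ℝ) :
    Lfin x δ u v = ∑ γ : DomainSAW unitDisk δ u v, (γ.length : ℝ) * x ^ γ.length :=
  finsum_eq_sum_of_fintype _

/-- `Z` is nondecreasing in `x ≥ 0`. [folklore] -/
theorem Zfin_mono {x y : ℝ} (hx : 0 ≤ x) (hxy : x ≤ y) : Zfin x δ u v ≤ Zfin y δ u v := by
  rw [Zfin_eq_sum, Zfin_eq_sum]
  exact Finset.sum_le_sum fun γ _ => pow_le_pow_left₀ hx hxy _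

/-- The termwise sign fact behind the monotonicity of the mean length: for naturals `p, q` and
`0 ≤ x ≤ y`, `(p - q)(y^p x^q - x^p y^q) ≥ 0`. [folklore] -/
theorem sub_mul_pow_sub_nonneg {x y : ℝ} (hx : 0 ≤ x) (hxy : x ≤ y) (p q : ℕ) :
    0 ≤ ((p : ℝ) - q) * (y ^ p * x ^ q - x ^ p * y ^ q) := by
  have hy : 0 ≤ y := hx.trans hxy
  rcases le_total q p with hqp | hpq
  · obtain ⟨d, rfl⟩ := Nat.exists_eq_add_of_le hqp
    have hd : x ^ d ≤ y ^ d := pow_le_pow_left₀ hx hxy d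
    have h1 : (0 : ℝ) ≤ ((q + d : ℕ) : ℝ) - q := by push_cast; linarith
    have h2 : 0 ≤ y ^ (q + d) * x ^ q - x ^ (q + d) * y ^ q := by
      rw [pow_add, pow_add]
      have : x ^ q * x ^ d * y ^ q ≤ y ^ q * y ^ d * x ^ q := by
        calc x ^ q * x ^ d * y ^ q = (x ^ q * y ^ q) * x ^ d := by ring
          _ ≤ (x ^ q * y ^ q) * y ^ d :=
            mul_le_mul_of_nonneg_left hd (mul_nonneg (pow_nonneg hx _) (pow_nonneg hy _))
          _ = y ^ q * y ^ d * x ^ q := by ring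
      linarith
    exact mul_nonneg h1 h2
  · obtain ⟨d, rfl⟩ := Nat.exists_eq_add_of_le hpq
    have hd : x ^ d ≤ y ^ d := pow_le_pow_left₀ hx hxy d
    have h1 : ((p : ℝ) - ((p + d : ℕ) : ℝ)) ≤ 0 := by push_cast; linarith
    have h2 : y ^ p * x ^ (p + d) - x ^ p * y ^ (p + d) ≤ 0 := by
      rw [pow_add, pow_add]
      have : y ^ p * (x ^ p * x ^ d) ≤ x ^ p * (y ^ p * y ^ d) := by
        calc y ^ p * (x ^ p * x ^ d) = (x ^ p * y ^ p) * x ^ d := by ring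
          _ ≤ (x ^ p * y ^ p) * y ^ d :=
            mul_le_mul_of_nonneg_left hd (mul_nonneg (pow_nonneg hx _) (pow_nonneg hy _))
          _ = x ^ p * (y ^ p * y ^ d) := by ring
      linarith
    exact mul_nonneg_of_nonpos_of_nonpos h1 h2

/-- **Cross inequality**: `(Σ |γ| x^{|γ|})(Σ y^{|γ|}) ≤ (Σ |γ| y^{|γ|})(Σ x^{|γ|})` for
`0 ≤ x ≤ y` (the family `x^{|γ|}` has monotone likelihood ratio in `|γ|`; symmetrisation of the
double sum). [folklore] -/
theorem Lfin_mul_Zfin_le {x y : ℝ} (hx : 0 ≤ x) (hxy : x ≤ y) :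
    Lfin x δ u v * Zfin y δ u v ≤ Lfin y δ u v * Zfin x δ u v := by
  rw [Lfin_eq_sum, Lfin_eq_sum, Zfin_eq_sum, Zfin_eq_sum]
  set n : DomainSAW unitDisk δ u v → ℕ := fun γ => γ.length with hn
  -- the antisymmetric kernel
  set a : DomainSAW unitDisk δ u v → DomainSAW unitDisk δ u v → ℝ :=
    fun i j => y ^ n i * x ^ n j - x ^ n i * y ^ n j with ha
  have hanti : ∀ i j, a j i = -a i j := by intro i j; simp only [ha]; ring
  -- S = RHS - LHS as a double sum
  have hS : (∑ i, (n i : ℝ) * y ^ n i) * (∑ j, x ^ n j) - (∑ i, (n i : ℝ) * x ^ n i) * (∑ j, y ^ n j)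
      = ∑ i, ∑ j, (n i : ℝ) * a i j := by
    rw [Finset.sum_mul_sum, Finset.sum_mul_sum, ← Finset.sum_sub_distrib]
    refine Finset.sum_congr rfl fun i _ => ?_
    rw [← Finset.sum_sub_distrib]
    refine Finset.sum_congr rfl fun j _ => ?_
    simp only [ha]; ring
  have hS' : ∑ i, ∑ j, (n i : ℝ) * a i j = -∑ i, ∑ j, (n j : ℝ) * a i j := by
    rw [Finset.sum_comm]
    rw [← Finset.sum_neg_distrib]
    refine Finset.sum_congr rfl fun i _ => ?_
    rw [← Finset.sum_neg_distrib]
    refine Finset.sum_congr rfl fun j _ => ?_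
    rw [hanti j i]; ring
  have h2S : 2 * ∑ i, ∑ j, (n i : ℝ) * a i j = ∑ i, ∑ j, ((n i : ℝ) - n j) * a i j := by
    have : ∑ i, ∑ j, ((n i : ℝ) - n j) * a i j
        = ∑ i, ∑ j, (n i : ℝ) * a i j - ∑ i, ∑ j, (n j : ℝ) * a i j := by
      rw [← Finset.sum_sub_distrib]
      refine Finset.sum_congr rfl fun i _ => ?_
      rw [← Finset.sum_sub_distrib]
      refine Finset.sum_congr rfl fun j _ => ?_
      ring
    rw [this, hS']
    ring
  have hpos : 0 ≤ ∑ i, ∑ j, ((n i : ℝ) - n j) * a i j :=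
    Finset.sum_nonneg fun i _ => Finset.sum_nonneg fun j _ => sub_mul_pow_sub_nonneg hx hxy (n i) (n j)
  have : 0 ≤ (∑ i, (n i : ℝ) * y ^ n i) * (∑ j, x ^ n j) - (∑ i, (n i : ℝ) * x ^ n i) * (∑ j, y ^ n j) := by
    rw [hS]; linarith
  linarith

/-- **The mean length is nondecreasing in the fugacity** (`0 < x ≤ y`, `Z(x) > 0`): the
finite-volume, everywhere-in-`x` monotonicity that transfers density bounds across `x_c`.
[folklore] -/
theorem meanLength_mono {x y : ℝ} (hx : 0 < x) (hxy : x ≤ y) (hZ : 0 < Zfin x δ u v) :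
    meanLength x δ u v ≤ meanLength y δ u v := by
  have hZy : 0 < Zfin y δ u v := hZ.trans_le (Zfin_mono hx.le hxy)
  rw [meanLength, meanLength, div_le_div_iff₀ hZ hZy]
  exact Lfin_mul_Zfin_le hx.le hxy

/-- **Jensen / convexity of `log Z` in `log x`**: `E_x|γ| · log(y/x) ≤ log Z(y) - log Z(x)` for
`x, y > 0` — i.e. `Z(y)/Z(x) = E_x[(y/x)^{|γ|}] ≥ (y/x)^{E_x|γ|}`. With `(x, y) = (x_c, x)` this
reads: the supercritical free-energy increment bounds the CRITICAL mean length; with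
`(x, y) = (x, x_c)`: `log Z(x) - log Z(x_c) ≤ E_x|γ| · log(x/x_c)`. [folklore] -/
theorem meanLength_mul_log_le {x y : ℝ} (hx : 0 < x) (hy : 0 < y) (hZ : 0 < Zfin x δ u v) :
    meanLength x δ u v * Real.log (y / x) ≤ Real.log (Zfin y δ u v) - Real.log (Zfin x δ u v) := by
  classical
  set n : DomainSAW unitDisk δ u v → ℕ := fun γ => γ.length with hn
  set w : DomainSAW unitDisk δ u v → ℝ := fun γ => x ^ n γ / Zfin x δ u v with hw
  set p : DomainSAW unitDisk δ u v → ℝ := fun γ => (n γ : ℝ) * Real.log (y / x) with hp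
  have hw0 : ∀ γ ∈ (Finset.univ : Finset (DomainSAW unitDisk δ u v)), 0 ≤ w γ :=
    fun γ _ => div_nonneg (pow_nonneg hx.le _) hZ.le
  have hw1 : ∑ γ, w γ = 1 := by
    simp only [hw]
    rw [← Finset.sum_div, ← Zfin_eq_sum, div_self hZ.ne']
  have hJ := (convexOn_exp).map_sum_le hw0 hw1 (fun γ _ => Set.mem_univ (p γ))
  -- left-hand side: `exp (E_x|γ| · log(y/x))`
  have hL : ∑ γ, w γ • p γ = meanLength x δ u v * Real.log (y / x) := by
    simp only [hw, hp, smul_eq_mul]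
    rw [meanLength, Lfin_eq_sum, Finset.sum_div, Finset.sum_mul]
    refine Finset.sum_congr rfl fun γ _ => ?_
    ring
  -- right-hand side: `Z(y)/Z(x)`
  have hR : ∑ γ, w γ • Real.exp (p γ) = Zfin y δ u v / Zfin x δ u v := by
    simp only [hw, hp, smul_eq_mul]
    rw [Zfin_eq_sum y, Finset.sum_div]
    refine Finset.sum_congr rfl fun γ _ => ?_
    rw [Real.exp_nat_mul, Real.exp_log (div_pos hy hx), div_pow,
      div_mul_div_comm, mul_comm (x ^ n γ), ← div_mul_div_comm, div_self (pow_ne_zero _ hx.ne'),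
      mul_one]
  rw [hL, hR] at hJ
  have hZy : 0 < Zfin y δ u v := by
    rw [Zfin_eq_sum]
    have hne : (Finset.univ : Finset (DomainSAW unitDisk δ u v)).Nonempty := by
      by_contra h
      rw [Finset.not_nonempty_iff_eq_empty] at h
      have : Zfin x δ u v = 0 := by rw [Zfin_eq_sum, h, Finset.sum_empty]
      exact hZ.ne' this
    exact Finset.sum_pos (fun γ _ => pow_pos hy _) hne
  calc meanLength x δ u v * Real.log (y / x)
      = Real.log (Real.exp (meanLength x δ u v * Real.log (y / x))) := (Real.log_exp _).symm
    _ ≤ Real.log (Zfin y δ u v / Zfin x δ u v) := Real.log_le_log (Real.exp_pos _) hJ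
    _ = Real.log (Zfin y δ u v) - Real.log (Zfin x δ u v) := Real.log_div hZy.ne' hZ.ne'

/-- **Markov's inequality for the length**: `Σ_{|γ| ≥ L} x^{|γ|} ≤ L⁻¹ Σ |γ| x^{|γ|}` (`L > 0`,
`x ≥ 0`). [folklore] -/
theorem sum_filter_le_length_le {x L : ℝ} (hx : 0 ≤ x) (hL : 0 < L) :
    ∑ γ ∈ Finset.univ.filter (fun γ : DomainSAW unitDisk δ u v => L ≤ (γ.length : ℝ)), x ^ γ.length
      ≤ Lfin x δ u v / L := by
  classical
  rw [Lfin_eq_sum, le_div_iff₀ hL, Finset.sum_mul]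
  calc ∑ γ ∈ Finset.univ.filter (fun γ : DomainSAW unitDisk δ u v => L ≤ (γ.length : ℝ)), x ^ γ.length * L
      ≤ ∑ γ ∈ Finset.univ.filter (fun γ : DomainSAW unitDisk δ u v => L ≤ (γ.length : ℝ)),
          (γ.length : ℝ) * x ^ γ.length := by
        refine Finset.sum_le_sum fun γ hγ => ?_
        have hLγ : L ≤ γ.length := (Finset.mem_filter.1 hγ).2
        rw [mul_comm]
        exact mul_le_mul_of_nonneg_right hLγ (pow_nonneg hx _)
    _ ≤ ∑ γ : DomainSAW unitDisk δ u v, (γ.length : ℝ) * x ^ γ.length :=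
        Finset.sum_le_sum_of_subset_of_nonneg (Finset.filter_subset _ _)
          fun γ _ _ => mul_nonneg (Nat.cast_nonneg _) (pow_nonneg hx _)

/-- **Chebyshev**: `(Σ_{|γ| ≥ L} x^{|γ|}) · t^L ≤ Σ_γ (x t)^{|γ|} = Z(x t)` for `t ≥ 1`, `x ≥ 0` — the
partition function at the larger fugacity `x t` bounds the upper tail of the length at `x`.
[folklore] -/
theorem sum_filter_mul_rpow_le {x t L : ℝ} (hx : 0 ≤ x) (ht : 1 ≤ t) :
    (∑ γ ∈ Finset.univ.filter (fun γ : DomainSAW unitDisk δ u v => L ≤ (γ.length : ℝ)), x ^ γ.length)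
        * t ^ L ≤ Zfin (x * t) δ u v := by
  classical
  rw [Zfin_eq_sum, Finset.sum_mul]
  calc ∑ γ ∈ Finset.univ.filter (fun γ : DomainSAW unitDisk δ u v => L ≤ (γ.length : ℝ)), x ^ γ.length * t ^ L
      ≤ ∑ γ ∈ Finset.univ.filter (fun γ : DomainSAW unitDisk δ u v => L ≤ (γ.length : ℝ)), (x * t) ^ γ.length := by
        refine Finset.sum_le_sum fun γ hγ => ?_
        have hLγ : L ≤ γ.length := (Finset.mem_filter.1 hγ).2
        rw [mul_pow]
        refine mul_le_mul_of_nonneg_left ?_ (pow_nonneg hx _)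
        calc t ^ L ≤ t ^ (γ.length : ℝ) := Real.rpow_le_rpow_of_exponent_le ht hLγ
          _ = t ^ γ.length := Real.rpow_natCast t γ.length
    _ ≤ ∑ γ : DomainSAW unitDisk δ u v, (x * t) ^ γ.length :=
        Finset.sum_le_sum_of_subset_of_nonneg (Finset.filter_subset _ _)
          fun γ _ _ => pow_nonneg (mul_nonneg hx (zero_le_one.trans ht)) _

end Sums

/-! ### The disc: positivity, the maximal length, the density event -/

section Disc

/-- For `δ > 0` and `u, v ∈ 𝔻_δ` the partition function is positive at every `x > 0`.
[cite: DuminilCopinKozmaYadin2014, §1 (definition of P_{(Ω_δ,a_δ,b_δ,x)})] -/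
theorem Zfin_pos (hδ : 0 < δ) (hu : u ∈ meshDomain unitDisk δ) (hv : v ∈ meshDomain unitDisk δ)
    {x : ℝ} (hx : 0 < x) : 0 < Zfin x δ u v := by
  classical
  haveI := finite_domainSAW (v := v) hδ hu
  haveI : Fintype (DomainSAW unitDisk δ u v) := Fintype.ofFinite _
  rw [Zfin_eq_sum]
  exact sum_pow_length_pos hδ hu hv hx

/-- `𝔻_δ` is a finite set of sites (`δ > 0`). [folklore] -/
theorem finite_meshDomain_unitDisk (hδ : 0 < δ) : (meshDomain unitDisk δ).Finite :=
  (Finset.finite_toSet _).subset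
    (meshDomain_subset_box (Ω := unitDisk) (R := 1) Metric.ball_subset_closedBall hδ)

/-- **The maximal length**: a SAW of `𝔻_δ` has at most `|𝔻_δ| ≤ 25/δ²` steps (`0 < δ ≤ 1`).
[folklore] -/
theorem length_le_div_sq (hδ : 0 < δ) (hδ1 : δ ≤ 1) (γ : DomainSAW unitDisk δ u v) :
    (γ.length : ℝ) ≤ 25 / δ ^ 2 := by
  have h1 := length_le_ncard_meshDomain (finite_meshDomain_unitDisk hδ) γ
  have h2 := ncard_meshDomain_le (Ω := unitDisk) (R := 1) Metric.ball_subset_closedBall hδ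
  have h3 := ceil_sq_le hδ hδ1
  calc (γ.length : ℝ) ≤ ((meshDomain unitDisk δ).ncard : ℝ) := by exact_mod_cast h1
    _ ≤ ((2 * ⌈1 / δ⌉₊ + 1 : ℕ) : ℝ) ^ 2 := by
        have : ((meshDomain unitDisk δ).ncard : ℝ) ≤ (((2 * ⌈(1 : ℝ) / δ⌉₊ + 1) ^ 2 : ℕ) : ℝ) := by
          exact_mod_cast h2
        simpa using this
    _ ≤ 25 / δ ^ 2 := h3

/-- The density event `{ρ ≤ δ² |γ|}` is the length event `{ρ/δ² ≤ |γ|}` (`δ > 0`). [folklore] -/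
theorem setOf_density_eq (hδ : 0 < δ) (ρ : ℝ) :
    {γ : DomainSAW unitDisk δ u v | ρ ≤ δ ^ 2 * γ.length} = {γ | ρ / δ ^ 2 ≤ (γ.length : ℝ)} := by
  ext γ
  simp only [Set.mem_setOf_eq]
  rw [div_le_iff₀ (pow_pos hδ 2), mul_comm]

/-- **The law of a length event as a ratio of sums.** [cite: DuminilCopinKozmaYadin2014, §1 (definition of P_{(Ω_δ,a_δ,b_δ,x)})] -/
theorem lawAt_setOf_le_length_eq (hδ : 0 < δ) (hu : u ∈ meshDomain unitDisk δ)
    (hv : v ∈ meshDomain unitDisk δ) {x : ℝ} (hx : 0 < x) [Fintype (DomainSAW unitDisk δ u v)] (L : ℝ) :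
    lawAt x unitDisk δ u v {γ | L ≤ (γ.length : ℝ)} = ENNReal.ofReal
      ((∑ γ ∈ Finset.univ.filter (fun γ : DomainSAW unitDisk δ u v => L ≤ (γ.length : ℝ)), x ^ γ.length)
        / Zfin x δ u v) := by
  classical
  rw [lawAt_apply_eq_ofReal_div hδ hu hv hx, Zfin_eq_sum]
  rfl

/-- **Markov**: `P_{(𝔻_δ,u,v,x)}[|γ| ≥ L] ≤ E_x|γ| / L`. [folklore] -/
theorem lawAt_setOf_le_length_le_meanLength_div (hδ : 0 < δ) (hu : u ∈ meshDomain unitDisk δ)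
    (hv : v ∈ meshDomain unitDisk δ) {x L : ℝ} (hx : 0 < x) (hL : 0 < L) :
    lawAt x unitDisk δ u v {γ | L ≤ (γ.length : ℝ)} ≤ ENNReal.ofReal (meanLength x δ u v / L) := by
  classical
  haveI := finite_domainSAW (v := v) hδ hu
  haveI : Fintype (DomainSAW unitDisk δ u v) := Fintype.ofFinite _
  have hZ := Zfin_pos hδ hu hv hx
  rw [lawAt_setOf_le_length_eq hδ hu hv hx]
  refine ENNReal.ofReal_le_ofReal ?_
  rw [div_le_iff₀ hZ, meanLength, div_right_comm, div_mul_cancel₀ _ hZ.ne']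
  exact sum_filter_le_length_le hx.le hL

/-- **Markov for the density**: `P_{(𝔻_δ,u,v,x)}[δ²|γ| ≥ ρ] ≤ δ² E_x|γ| / ρ`. [folklore] -/
theorem lawAt_density_le (hδ : 0 < δ) (hu : u ∈ meshDomain unitDisk δ) (hv : v ∈ meshDomain unitDisk δ)
    {x ρ : ℝ} (hx : 0 < x) (hρ : 0 < ρ) :
    lawAt x unitDisk δ u v {γ | ρ ≤ δ ^ 2 * γ.length}
      ≤ ENNReal.ofReal (δ ^ 2 * meanLength x δ u v / ρ) := by
  rw [setOf_density_eq hδ]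
  refine (lawAt_setOf_le_length_le_meanLength_div hδ hu hv hx (div_pos hρ (pow_pos hδ 2))).trans ?_
  rw [div_div_eq_mul_div, mul_comm]

/-- **Chebyshev from above**: `P_{x_c}[|γ| ≥ L] ≤ Z(x_c t)/(Z(x_c) t^L)` for `t ≥ 1` — the
supercritical partition function at `x = x_c t` bounds the upper tail of the CRITICAL length.
[folklore] -/
theorem lawAt_setOf_le_length_le_Zfin_div (hδ : 0 < δ) (hu : u ∈ meshDomain unitDisk δ)
    (hv : v ∈ meshDomain unitDisk δ) {x t : ℝ} (hx : 0 < x) (ht : 1 ≤ t) (L : ℝ) :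
    lawAt x unitDisk δ u v {γ | L ≤ (γ.length : ℝ)}
      ≤ ENNReal.ofReal (Zfin (x * t) δ u v / (Zfin x δ u v * t ^ L)) := by
  classical
  haveI := finite_domainSAW (v := v) hδ hu
  haveI : Fintype (DomainSAW unitDisk δ u v) := Fintype.ofFinite _
  have hZ := Zfin_pos hδ hu hv hx
  have htL : 0 < t ^ L := Real.rpow_pos_of_pos (zero_lt_one.trans_le ht) L
  rw [lawAt_setOf_le_length_eq hδ hu hv hx]
  refine ENNReal.ofReal_le_ofReal ?_
  rw [div_le_div_iff₀ hZ (mul_pos hZ htL)]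
  have := sum_filter_mul_rpow_le (δ := δ) (u := u) (v := v) (L := L) hx.le ht
  calc (∑ γ ∈ Finset.univ.filter (fun γ : DomainSAW unitDisk δ u v => L ≤ (γ.length : ℝ)), x ^ γ.length)
        * (Zfin x δ u v * t ^ L)
      = ((∑ γ ∈ Finset.univ.filter (fun γ : DomainSAW unitDisk δ u v => L ≤ (γ.length : ℝ)), x ^ γ.length)
          * t ^ L) * Zfin x δ u v := by ring
    _ ≤ Zfin (x * t) δ u v * Zfin x δ u v := mul_le_mul_of_nonneg_right this hZ.le

/-- **The moment generating function split at a length threshold**: for `t ≥ 1`, `0 < δ ≤ 1`,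
`Z(x t) ≤ Z(x) · (t^L + t^{25/δ²} · P_x[|γ| ≥ L])` (walks shorter than `L` gain at most `t^L`,
the others at most `t^{|𝔻_δ|}`). [folklore] -/
theorem Zfin_mul_le (hδ : 0 < δ) (hδ1 : δ ≤ 1) (hu : u ∈ meshDomain unitDisk δ)
    (hv : v ∈ meshDomain unitDisk δ) {x t : ℝ} (hx : 0 < x) (ht : 1 ≤ t) (L : ℝ) :
    Zfin (x * t) δ u v ≤ Zfin x δ u v *
      (t ^ L + t ^ (25 / δ ^ 2) * (lawAt x unitDisk δ u v {γ | L ≤ (γ.length : ℝ)}).toReal) := by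
  classical
  haveI := finite_domainSAW (v := v) hδ hu
  haveI : Fintype (DomainSAW unitDisk δ u v) := Fintype.ofFinite _
  have hZ := Zfin_pos hδ hu hv hx
  have ht0 : 0 < t := zero_lt_one.trans_le ht
  set F : Finset (DomainSAW unitDisk δ u v) :=
    Finset.univ.filter (fun γ : DomainSAW unitDisk δ u v => L ≤ (γ.length : ℝ)) with hF
  have hP : (lawAt x unitDisk δ u v {γ | L ≤ (γ.length : ℝ)}).toReal
      = (∑ γ ∈ F, x ^ γ.length) / Zfin x δ u v := by
    rw [lawAt_setOf_le_length_eq hδ hu hv hx, ENNReal.toReal_ofReal]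
    exact div_nonneg (Finset.sum_nonneg fun γ _ => pow_nonneg hx.le _) hZ.le
  rw [hP, mul_add, mul_comm (Zfin x δ u v) (t ^ (25 / δ ^ 2) * _), mul_assoc,
    div_mul_cancel₀ _ hZ.ne']
  -- split the sum defining `Z(x t)` at the threshold
  rw [Zfin_eq_sum, Zfin_eq_sum, ← Finset.sum_filter_add_sum_filter_not Finset.univ
    (fun γ : DomainSAW unitDisk δ u v => L ≤ (γ.length : ℝ))]
  rw [add_comm]
  refine add_le_add ?_ ?_
  · -- short walks: `(x t)^n = x^n t^n ≤ x^n t^L`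
    rw [Finset.sum_mul]
    calc ∑ γ ∈ Finset.univ.filter (fun γ : DomainSAW unitDisk δ u v => ¬ L ≤ (γ.length : ℝ)), (x * t) ^ γ.length
        ≤ ∑ γ ∈ Finset.univ.filter (fun γ : DomainSAW unitDisk δ u v => ¬ L ≤ (γ.length : ℝ)), x ^ γ.length * t ^ L := by
          refine Finset.sum_le_sum fun γ hγ => ?_
          have hγL : (γ.length : ℝ) ≤ L := (not_le.1 (Finset.mem_filter.1 hγ).2).le
          rw [mul_pow]
          refine mul_le_mul_of_nonneg_left ?_ (pow_nonneg hx.le _)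
          calc t ^ γ.length = t ^ (γ.length : ℝ) := (Real.rpow_natCast t γ.length).symm
            _ ≤ t ^ L := Real.rpow_le_rpow_of_exponent_le ht hγL
      _ ≤ ∑ γ : DomainSAW unitDisk δ u v, x ^ γ.length * t ^ L :=
          Finset.sum_le_sum_of_subset_of_nonneg (Finset.filter_subset _ _)
            fun γ _ _ => mul_nonneg (pow_nonneg hx.le _) (Real.rpow_nonneg ht0.le _)
  · -- long walks: `(x t)^n ≤ x^n t^{25/δ²}`
    rw [Finset.mul_sum]
    refine Finset.sum_le_sum fun γ _ => ?_
    rw [mul_pow, mul_comm (t ^ (25 / δ ^ 2))]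
    refine mul_le_mul_of_nonneg_left ?_ (pow_nonneg hx.le _)
    calc t ^ γ.length = t ^ (γ.length : ℝ) := (Real.rpow_natCast t γ.length).symm
      _ ≤ t ^ (25 / δ ^ 2) := Real.rpow_le_rpow_of_exponent_le ht (length_le_div_sq hδ hδ1 γ)

end Disc

/-! ### Transfer across `x_c`: the audit theorems -/

section Transfer

variable {A B : ℝ → Site 2}

/-- Along `δ → 0⁺`, eventually `0 < δ ≤ 1`. [folklore] -/
theorem eventually_pos_and_le_one : ∀ᶠ δ in 𝓝[>] (0 : ℝ), 0 < δ ∧ δ ≤ 1 := by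
  filter_upwards [self_mem_nhdsWithin, (eventually_lt_nhds zero_lt_one).filter_mono nhdsWithin_le_nhds]
    with δ hδ hδ1
  exact ⟨hδ, hδ1.le⟩

/-- **Monotone transfer at fixed mesh**: the CRITICAL mean length is at most the supercritical one,
`E_{(𝔻_δ,u,v,x_c)}|γ| ≤ E_{(𝔻_δ,u,v,x)}|γ|` for every `x ≥ x_c` and every `δ > 0` — a one-sided
bound crossing `x_c` with no input. [folklore] -/
theorem meanLength_criticalFugacity_le (hδ : 0 < δ) (hu : u ∈ meshDomain unitDisk δ)
    (hv : v ∈ meshDomain unitDisk δ) {x : ℝ} (hx : criticalFugacity ≤ x) :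
    meanLength criticalFugacity δ u v ≤ meanLength x δ u v := by
  classical
  haveI := finite_domainSAW (v := v) hδ hu
  haveI : Fintype (DomainSAW unitDisk δ u v) := Fintype.ofFinite _
  have hc0 := criticalFugacity_pos_lt_one'.1
  exact meanLength_mono hc0 hx (Zfin_pos hδ hu hv hc0)

/-- **Convex transfer at fixed mesh** (two Jensen inequalities): for `x > x_c` and `δ > 0`,
`E_{x_c}|γ_δ| · log(x/x_c) ≤ log Z_δ(x) - log Z_δ(x_c) ≤ E_x|γ_δ| · log(x/x_c)` — the
supercritical free-energy increment is squeezed between the critical and the supercritical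
mean lengths; equivalently `Z_δ(x)/Z_δ(x_c) = E_{x_c,δ}[(x/x_c)^{|γ_δ|}]` is the moment generating
function of the CRITICAL length. [folklore] -/
theorem log_Zfin_sub_log_Zfin_mem (hδ : 0 < δ) (hu : u ∈ meshDomain unitDisk δ)
    (hv : v ∈ meshDomain unitDisk δ) {x : ℝ} (hx : criticalFugacity < x) :
    meanLength criticalFugacity δ u v * Real.log (x / criticalFugacity)
        ≤ Real.log (Zfin x δ u v) - Real.log (Zfin criticalFugacity δ u v) ∧
      Real.log (Zfin x δ u v) - Real.log (Zfin criticalFugacity δ u v)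
        ≤ meanLength x δ u v * Real.log (x / criticalFugacity) := by
  classical
  haveI := finite_domainSAW (v := v) hδ hu
  haveI : Fintype (DomainSAW unitDisk δ u v) := Fintype.ofFinite _
  have hc0 := criticalFugacity_pos_lt_one'.1
  have hx0 : 0 < x := hc0.trans hx
  refine ⟨meanLength_mul_log_le hc0 hx0 (Zfin_pos hδ hu hv hc0), ?_⟩
  have hJ := meanLength_mul_log_le hx0 hc0 (Zfin_pos hδ hu hv hx0)
  have hl : Real.log (criticalFugacity / x) = -Real.log (x / criticalFugacity) := by
    rw [Real.log_div hc0.ne' hx0.ne', Real.log_div hx0.ne' hc0.ne']; ring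
  rw [hl] at hJ
  linarith

/-- **(F) ⇒ (LD)**: if the free-energy increment is flat at `x_c⁺` — for every `ε > 0` some
`x > x_c` has `δ² (log Z_δ(x) - log Z_δ(x_c)) ≤ ε log(x/x_c)` for all small `δ` — then dense
critical configurations are exponentially rare: for every `ρ > 0` there is `c > 0` with
`P_{(𝔻_δ,a_δ,b_δ,x_c)}[δ²|γ_δ| ≥ ρ] ≤ e^{-c/δ²}` for all small `δ` (Chebyshev on the moment
generating function of the critical length). [folklore] -/
theorem expRare_of_flat (hA : ∀ δ : ℝ, 0 < δ → A δ ∈ meshDomain unitDisk δ)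
    (hB : ∀ δ : ℝ, 0 < δ → B δ ∈ meshDomain unitDisk δ)
    (hF : ∀ ε : ℝ, 0 < ε → ∃ x : ℝ, criticalFugacity < x ∧ ∀ᶠ δ in 𝓝[>] (0 : ℝ),
      δ ^ 2 * (Real.log (Zfin x δ (A δ) (B δ)) - Real.log (Zfin criticalFugacity δ (A δ) (B δ)))
        ≤ ε * Real.log (x / criticalFugacity))
    {ρ : ℝ} (hρ : 0 < ρ) :
    ∃ c : ℝ, 0 < c ∧ ∀ᶠ δ in 𝓝[>] (0 : ℝ),
      lawAt criticalFugacity unitDisk δ (A δ) (B δ) {γ | ρ ≤ δ ^ 2 * γ.length}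
        ≤ ENNReal.ofReal (Real.exp (-(c / δ ^ 2))) := by
  have hc0 := criticalFugacity_pos_lt_one'.1
  obtain ⟨x, hx, hev⟩ := hF (ρ / 2) (by positivity)
  have hx0 : 0 < x := hc0.trans hx
  set t : ℝ := x / criticalFugacity with ht_def
  have ht : 1 < t := (one_lt_div hc0).2 hx
  have ht0 : 0 < t := zero_lt_one.trans ht
  have hlogt : 0 < Real.log t := Real.log_pos ht
  have hxt : criticalFugacity * t = x := by rw [ht_def]; field_simp
  refine ⟨ρ / 2 * Real.log t, by positivity, ?_⟩
  filter_upwards [hev, self_mem_nhdsWithin] with δ hδF hδ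
  replace hδ : 0 < δ := hδ
  have hδ2 : 0 < δ ^ 2 := pow_pos hδ 2
  have hZc := Zfin_pos hδ (hA δ hδ) (hB δ hδ) hc0
  have hZx := Zfin_pos hδ (hA δ hδ) (hB δ hδ) hx0
  rw [setOf_density_eq hδ]
  refine (lawAt_setOf_le_length_le_Zfin_div hδ (hA δ hδ) (hB δ hδ) hc0 ht.le (ρ / δ ^ 2)).trans ?_
  rw [hxt]
  refine ENNReal.ofReal_le_ofReal ?_
  have htL : 0 < t ^ (ρ / δ ^ 2) := Real.rpow_pos_of_pos ht0 _
  rw [div_le_iff₀ (mul_pos hZc htL)]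
  have key : Real.log (Zfin x δ (A δ) (B δ))
      ≤ Real.log (Zfin criticalFugacity δ (A δ) (B δ)) + ρ / 2 * Real.log t / δ ^ 2 := by
    rw [← sub_le_iff_le_add', le_div_iff₀ hδ2]
    linarith
  calc Zfin x δ (A δ) (B δ) = Real.exp (Real.log (Zfin x δ (A δ) (B δ))) := (Real.exp_log hZx).symm
    _ ≤ Real.exp (Real.log (Zfin criticalFugacity δ (A δ) (B δ)) + ρ / 2 * Real.log t / δ ^ 2) :=
        Real.exp_le_exp.2 key
    _ = Real.exp (-(ρ / 2 * Real.log t / δ ^ 2)) *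
          (Zfin criticalFugacity δ (A δ) (B δ) * t ^ (ρ / δ ^ 2)) := by
        rw [Real.rpow_def_of_pos ht0]
        conv_rhs => rw [← Real.exp_log hZc, ← Real.exp_add, ← Real.exp_add]
        congr 1
        ring

/-- **(LD) ⇒ (F)**: if dense critical configurations are exponentially rare, the free-energy
increment is flat at `x_c⁺` (split the moment generating function of the critical length at
density `ε/2`; long walks have at most `25/δ²` steps). [folklore] -/
theorem flat_of_expRare (hA : ∀ δ : ℝ, 0 < δ → A δ ∈ meshDomain unitDisk δ)
    (hB : ∀ δ : ℝ, 0 < δ → B δ ∈ meshDomain unitDisk δ)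
    (hLD : ∀ ρ : ℝ, 0 < ρ → ∃ c : ℝ, 0 < c ∧ ∀ᶠ δ in 𝓝[>] (0 : ℝ),
      lawAt criticalFugacity unitDisk δ (A δ) (B δ) {γ | ρ ≤ δ ^ 2 * γ.length}
        ≤ ENNReal.ofReal (Real.exp (-(c / δ ^ 2))))
    {ε : ℝ} (hε : 0 < ε) :
    ∃ x : ℝ, criticalFugacity < x ∧ ∀ᶠ δ in 𝓝[>] (0 : ℝ),
      δ ^ 2 * (Real.log (Zfin x δ (A δ) (B δ)) - Real.log (Zfin criticalFugacity δ (A δ) (B δ)))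
        ≤ ε * Real.log (x / criticalFugacity) := by
  have hc0 := criticalFugacity_pos_lt_one'.1
  obtain ⟨c, hc, hev⟩ := hLD (ε / 2) (by positivity)
  set t : ℝ := Real.exp (c / 50) with ht_def
  have ht : 1 < t := Real.one_lt_exp_iff.2 (by positivity)
  have ht0 : 0 < t := zero_lt_one.trans ht
  have hlogt : Real.log t = c / 50 := Real.log_exp _
  have hlogt0 : 0 < Real.log t := by rw [hlogt]; positivity
  have hlog2 : 0 < Real.log 2 := Real.log_pos one_lt_two
  have hη : 0 < ε / 2 * Real.log t / Real.log 2 := by positivity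
  refine ⟨criticalFugacity * t, (lt_mul_iff_one_lt_right hc0).2 ht, ?_⟩
  have hquot : criticalFugacity * t / criticalFugacity = t := by field_simp
  filter_upwards [hev, eventually_pos_and_le_one,
    (eventually_lt_nhds hη).filter_mono nhdsWithin_le_nhds] with δ hδLD hδ01 hδη
  obtain ⟨hδ, hδ1⟩ := hδ01
  have hδ2 : 0 < δ ^ 2 := pow_pos hδ 2
  have hZc := Zfin_pos hδ (hA δ hδ) (hB δ hδ) hc0
  have hZx := Zfin_pos hδ (hA δ hδ) (hB δ hδ) (mul_pos hc0 ht0)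
  rw [hquot]
  -- the split of the moment generating function at density `ε/2`
  have hsplit := Zfin_mul_le hδ hδ1 (hA δ hδ) (hB δ hδ) hc0 ht.le (ε / 2 / δ ^ 2)
  have hP : (lawAt criticalFugacity unitDisk δ (A δ) (B δ)
      {γ | ε / 2 / δ ^ 2 ≤ (γ.length : ℝ)}).toReal ≤ Real.exp (-(c / δ ^ 2)) := by
    rw [← setOf_density_eq hδ (ε / 2)]
    exact ENNReal.toReal_le_of_le_ofReal (Real.exp_nonneg _) hδLD
  have h2 : t ^ (25 / δ ^ 2) * (lawAt criticalFugacity unitDisk δ (A δ) (B δ)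
      {γ | ε / 2 / δ ^ 2 ≤ (γ.length : ℝ)}).toReal ≤ t ^ (ε / 2 / δ ^ 2) := by
    calc t ^ (25 / δ ^ 2) * (lawAt criticalFugacity unitDisk δ (A δ) (B δ)
          {γ | ε / 2 / δ ^ 2 ≤ (γ.length : ℝ)}).toReal
        ≤ t ^ (25 / δ ^ 2) * Real.exp (-(c / δ ^ 2)) :=
          mul_le_mul_of_nonneg_left hP (Real.rpow_nonneg ht0.le _)
      _ = Real.exp ((25 * Real.log t - c) / δ ^ 2) := by
          rw [Real.rpow_def_of_pos ht0, ← Real.exp_add]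
          congr 1
          field_simp
          ring
      _ ≤ 1 := by
          rw [Real.exp_le_one_iff]
          refine div_nonpos_of_nonpos_of_nonneg ?_ hδ2.le
          rw [hlogt]
          linarith
      _ ≤ t ^ (ε / 2 / δ ^ 2) := Real.one_le_rpow ht.le (by positivity)
  have hZ : Zfin (criticalFugacity * t) δ (A δ) (B δ)
      ≤ Zfin criticalFugacity δ (A δ) (B δ) * (2 * t ^ (ε / 2 / δ ^ 2)) :=
    hsplit.trans (mul_le_mul_of_nonneg_left (by linarith) hZc.le)
  have htpow : 0 < t ^ (ε / 2 / δ ^ 2) := Real.rpow_pos_of_pos ht0 _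
  have hlog : Real.log (Zfin (criticalFugacity * t) δ (A δ) (B δ))
      - Real.log (Zfin criticalFugacity δ (A δ) (B δ)) ≤ Real.log 2 + ε / 2 / δ ^ 2 * Real.log t := by
    have h := Real.log_le_log hZx hZ
    rw [Real.log_mul hZc.ne' (by positivity), Real.log_mul two_ne_zero htpow.ne',
      Real.log_rpow ht0] at h
    linarith
  have hδsq : δ ^ 2 * Real.log 2 ≤ ε / 2 * Real.log t := by
    have hδδ : δ ^ 2 ≤ δ := by nlinarith
    calc δ ^ 2 * Real.log 2 ≤ δ * Real.log 2 := mul_le_mul_of_nonneg_right hδδ hlog2.le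
      _ ≤ (ε / 2 * Real.log t / Real.log 2) * Real.log 2 :=
          mul_le_mul_of_nonneg_right hδη.le hlog2.le
      _ = ε / 2 * Real.log t := div_mul_cancel₀ _ hlog2.ne'
  calc δ ^ 2 * (Real.log (Zfin (criticalFugacity * t) δ (A δ) (B δ))
        - Real.log (Zfin criticalFugacity δ (A δ) (B δ)))
      ≤ δ ^ 2 * (Real.log 2 + ε / 2 / δ ^ 2 * Real.log t) := mul_le_mul_of_nonneg_left hlog hδ2.le
    _ = δ ^ 2 * Real.log 2 + ε / 2 * Real.log t := by field_simp
    _ ≤ ε * Real.log t := by linarith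

/-- **(F) ⇒ (Θ)**: flatness of the free-energy increment gives right-continuity of the expected
density at `x_c`: for every `ρ > 0` some `x > x_c` has `δ² E_{(𝔻_δ,a_δ,b_δ,x)}|γ_δ| ≤ ρ` for all
small `δ` (Jensen between `x = √(x_c y)` and `y`). [folklore] -/
theorem densityRightContinuous_of_flat (hA : ∀ δ : ℝ, 0 < δ → A δ ∈ meshDomain unitDisk δ)
    (hB : ∀ δ : ℝ, 0 < δ → B δ ∈ meshDomain unitDisk δ)
    (hF : ∀ ε : ℝ, 0 < ε → ∃ x : ℝ, criticalFugacity < x ∧ ∀ᶠ δ in 𝓝[>] (0 : ℝ),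
      δ ^ 2 * (Real.log (Zfin x δ (A δ) (B δ)) - Real.log (Zfin criticalFugacity δ (A δ) (B δ)))
        ≤ ε * Real.log (x / criticalFugacity))
    {ρ : ℝ} (hρ : 0 < ρ) :
    ∃ x : ℝ, criticalFugacity < x ∧ ∀ᶠ δ in 𝓝[>] (0 : ℝ),
      δ ^ 2 * meanLength x δ (A δ) (B δ) ≤ ρ := by
  classical
  have hc0 := criticalFugacity_pos_lt_one'.1
  obtain ⟨y, hy, hev⟩ := hF (ρ / 2) (by positivity)
  have hy0 : 0 < y := hc0.trans hy
  set x : ℝ := Real.sqrt (criticalFugacity * y) with hx_def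
  have hxc : criticalFugacity < x := (Real.lt_sqrt hc0.le).2 (by nlinarith)
  have hx0 : 0 < x := hc0.trans hxc
  have hlog : Real.log (y / x) = Real.log (y / criticalFugacity) / 2 := by
    rw [Real.log_div hy0.ne' hx0.ne', Real.log_div hy0.ne' hc0.ne', hx_def,
      Real.log_sqrt (mul_pos hc0 hy0).le, Real.log_mul hc0.ne' hy0.ne']
    ring
  have hlogpos : 0 < Real.log (y / criticalFugacity) := Real.log_pos ((one_lt_div hc0).2 hy)
  refine ⟨x, hxc, ?_⟩
  filter_upwards [hev, self_mem_nhdsWithin] with δ hδF hδ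
  replace hδ : 0 < δ := hδ
  have hδ2 : 0 < δ ^ 2 := pow_pos hδ 2
  haveI := finite_domainSAW (v := B δ) hδ (hA δ hδ)
  haveI : Fintype (DomainSAW unitDisk δ (A δ) (B δ)) := Fintype.ofFinite _
  have hZc := Zfin_pos hδ (hA δ hδ) (hB δ hδ) hc0
  have hZx := Zfin_pos hδ (hA δ hδ) (hB δ hδ) hx0
  have hJ := meanLength_mul_log_le (δ := δ) (u := A δ) (v := B δ) hx0 hy0 hZx
  have hmono : Real.log (Zfin criticalFugacity δ (A δ) (B δ)) ≤ Real.log (Zfin x δ (A δ) (B δ)) :=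
    Real.log_le_log hZc (Zfin_mono hc0.le hxc.le)
  rw [hlog] at hJ
  have h3 : δ ^ 2 * meanLength x δ (A δ) (B δ) * (Real.log (y / criticalFugacity) / 2)
      ≤ ρ * (Real.log (y / criticalFugacity) / 2) := by
    calc δ ^ 2 * meanLength x δ (A δ) (B δ) * (Real.log (y / criticalFugacity) / 2)
        = δ ^ 2 * (meanLength x δ (A δ) (B δ) * (Real.log (y / criticalFugacity) / 2)) := by ring
      _ ≤ δ ^ 2 * (Real.log (Zfin y δ (A δ) (B δ)) - Real.log (Zfin criticalFugacity δ (A δ) (B δ))) :=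
          mul_le_mul_of_nonneg_left (by linarith) hδ2.le
      _ ≤ ρ / 2 * Real.log (y / criticalFugacity) := hδF
      _ = ρ * (Real.log (y / criticalFugacity) / 2) := by ring
  exact le_of_mul_le_mul_right h3 (by positivity)

/-- **(Θ) ⇒ (F)**: right-continuity of the expected density at `x_c` gives flatness of the
free-energy increment (the second Jensen inequality). [folklore] -/
theorem flat_of_densityRightContinuous (hA : ∀ δ : ℝ, 0 < δ → A δ ∈ meshDomain unitDisk δ)
    (hB : ∀ δ : ℝ, 0 < δ → B δ ∈ meshDomain unitDisk δ)
    (hΘ : ∀ ρ : ℝ, 0 < ρ → ∃ x : ℝ, criticalFugacity < x ∧ ∀ᶠ δ in 𝓝[>] (0 : ℝ),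
      δ ^ 2 * meanLength x δ (A δ) (B δ) ≤ ρ)
    {ε : ℝ} (hε : 0 < ε) :
    ∃ x : ℝ, criticalFugacity < x ∧ ∀ᶠ δ in 𝓝[>] (0 : ℝ),
      δ ^ 2 * (Real.log (Zfin x δ (A δ) (B δ)) - Real.log (Zfin criticalFugacity δ (A δ) (B δ)))
        ≤ ε * Real.log (x / criticalFugacity) := by
  have hc0 := criticalFugacity_pos_lt_one'.1
  obtain ⟨x, hx, hev⟩ := hΘ ε hε
  have hx0 : 0 < x := hc0.trans hx
  have hlogpos : 0 < Real.log (x / criticalFugacity) := Real.log_pos ((one_lt_div hc0).2 hx)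
  refine ⟨x, hx, ?_⟩
  filter_upwards [hev, self_mem_nhdsWithin] with δ hδΘ hδ
  replace hδ : 0 < δ := hδ
  have hδ2 : 0 < δ ^ 2 := pow_pos hδ 2
  have hJ := (log_Zfin_sub_log_Zfin_mem hδ (hA δ hδ) (hB δ hδ) hx).2
  calc δ ^ 2 * (Real.log (Zfin x δ (A δ) (B δ)) - Real.log (Zfin criticalFugacity δ (A δ) (B δ)))
      ≤ δ ^ 2 * (meanLength x δ (A δ) (B δ) * Real.log (x / criticalFugacity)) :=
        mul_le_mul_of_nonneg_left hJ hδ2.le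
    _ = (δ ^ 2 * meanLength x δ (A δ) (B δ)) * Real.log (x / criticalFugacity) := by ring
    _ ≤ ε * Real.log (x / criticalFugacity) := mul_le_mul_of_nonneg_right hδΘ hlogpos.le

/-- **(Θ) ⇒ zero critical density in expectation**: if the supercritical expected density is
right-continuous at `x_c` (`θ(x) → 0` as `x ↓ x_c`, DKY Problem 9's density), then
`δ² E_{(𝔻_δ,a_δ,b_δ,x_c)}|γ_δ| → 0` — by the monotone transfer alone. [folklore] -/
theorem tendsto_sq_mul_meanLength_criticalFugacity
    (hA : ∀ δ : ℝ, 0 < δ → A δ ∈ meshDomain unitDisk δ)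
    (hB : ∀ δ : ℝ, 0 < δ → B δ ∈ meshDomain unitDisk δ)
    (hΘ : ∀ ρ : ℝ, 0 < ρ → ∃ x : ℝ, criticalFugacity < x ∧ ∀ᶠ δ in 𝓝[>] (0 : ℝ),
      δ ^ 2 * meanLength x δ (A δ) (B δ) ≤ ρ) :
    Tendsto (fun δ : ℝ => δ ^ 2 * meanLength criticalFugacity δ (A δ) (B δ)) (𝓝[>] 0) (𝓝 0) := by
  have hc0 := criticalFugacity_pos_lt_one'.1
  rw [tendsto_order]
  refine ⟨fun a ha => Eventually.of_forall fun δ => ha.trans_le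
    (mul_nonneg (sq_nonneg δ) (meanLength_nonneg hc0.le)), fun b hb => ?_⟩
  obtain ⟨x, hx, hev⟩ := hΘ (b / 2) (by positivity)
  filter_upwards [hev, self_mem_nhdsWithin] with δ hδΘ hδ
  replace hδ : 0 < δ := hδ
  have hM := meanLength_criticalFugacity_le hδ (hA δ hδ) (hB δ hδ) hx.le
  calc δ ^ 2 * meanLength criticalFugacity δ (A δ) (B δ) ≤ δ ^ 2 * meanLength x δ (A δ) (B δ) :=
        mul_le_mul_of_nonneg_left hM (sq_nonneg δ)
    _ ≤ b / 2 := hδΘ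
    _ < b := by linarith

/-- **Zero critical density in expectation ⇒ in probability** (Markov): if
`δ² E_{x_c}|γ_δ| → 0` then `P_{(𝔻_δ,a_δ,b_δ,x_c)}[δ²|γ_δ| ≥ ρ] → 0` for every `ρ > 0`.
[folklore] -/
theorem tendsto_lawAt_density_of_tendsto_meanLength
    (hA : ∀ δ : ℝ, 0 < δ → A δ ∈ meshDomain unitDisk δ)
    (hB : ∀ δ : ℝ, 0 < δ → B δ ∈ meshDomain unitDisk δ)
    (hZ : Tendsto (fun δ : ℝ => δ ^ 2 * meanLength criticalFugacity δ (A δ) (B δ)) (𝓝[>] 0) (𝓝 0))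
    {ρ : ℝ} (hρ : 0 < ρ) :
    Tendsto (fun δ : ℝ => lawAt criticalFugacity unitDisk δ (A δ) (B δ)
      {γ | ρ ≤ δ ^ 2 * γ.length}) (𝓝[>] 0) (𝓝 0) := by
  have hc0 := criticalFugacity_pos_lt_one'.1
  have hup : Tendsto (fun δ : ℝ => ENNReal.ofReal
      (δ ^ 2 * meanLength criticalFugacity δ (A δ) (B δ) / ρ)) (𝓝[>] 0) (𝓝 0) := by
    rw [← ENNReal.ofReal_zero]
    refine ENNReal.tendsto_ofReal ?_
    simpa using hZ.div_const ρ
  refine tendsto_of_tendsto_of_tendsto_of_le_of_le' tendsto_const_nhds hup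
    (Eventually.of_forall fun _ => bot_le) ?_
  filter_upwards [self_mem_nhdsWithin] with δ hδ
  replace hδ : 0 < δ := hδ
  exact lawAt_density_le hδ (hA δ hδ) (hB δ hδ) hc0 hρ

end Transfer

end SupercriticalSAW

open SupercriticalSAW

/-! ### The narrowed barrier (gen 10): the density / free-energy axis -/

/-- **Barrier `SupercriticalSAWSpaceFilling`, NARROWED along the DENSITY / FREE-ENERGY axis**
(tenth audit of the mechanism file `…Proofs`, 2026-08-16). For the unit disc and ANY lattice
endpoints `a_δ = A δ`, `b_δ = B δ ∈ 𝔻_δ`: (1) at every fixed mesh the critical mean length is at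
most the supercritical one and the supercritical free-energy increment is squeezed between
them, `E_{x_c}|γ_δ| log(x/x_c) ≤ log Z_δ(x) - log Z_δ(x_c) ≤ E_x|γ_δ| log(x/x_c)` (`x > x_c`);
(2) right-continuity at `x_c` of the supercritical expected density (Θ) is EQUIVALENT to the
flatness of the free-energy increment at `x_c⁺` (F); (3) (F) is EQUIVALENT to the exponential
rarity, in `δ⁻²`, of dense configurations under the CRITICAL law (LD); (4) (Θ) implies ZERO
DENSITY of the critical walk, in expectation and in probability. So one-sided information does
cross `x_c` for scalar observables monotone or convex in the fugacity — which the parent entry's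
`evasions_known: none published for transferring information across x_c` overlooked.

BARRIER (structured block, D-0021):
- technique_class: fugacity-robust conclusions about the LAW of the walk (unchanged: `SupercriticalSAW.RobustSAWScalingLimit` and the classes delimited by gens 1–9 of the parent entry) — EXCLUDING scalar thermodynamic observables monotone or convex in `x` (mean length / density `E_x|γ_δ| = x (log Z_δ)'(x)`, free energy `δ² log Z_δ(x)`), for which the supercritical side bounds the critical point at every fixed `δ` (`SupercriticalSAW.meanLength_criticalFugacity_le`, `SupercriticalSAW.log_Zfin_sub_log_Zfin_mem`) and the supercritical free-energy increment is identically the cumulant generating function of the CRITICAL length, `Z_δ(x)/Z_δ(x_c) = E_{(𝔻_δ,a_δ,b_δ,x_c)}[(x/x_c)^{|γ_δ|}]` [cite: DuminilCopinKozmaYadin2014, §1 (definition of P_{(Ω_δ,a_δ,b_δ,x)})] [cite: DuminilCopinKozmaYadin2014, §4 (Problem 9)]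
- blocks: nothing new is blocked; what is ADDED is an unobstructed transfer: right-continuity at `x_c` of the density `θ(x)` of Problem 9 of the source ("show that there exists `θ(x) > 0` such that … `P(| |γ_δ| - θ(x)·|Ω_δ| | > ε|Ω_δ|) → 0` … The quantity `θ(x)` would thus be an averaged density of the walk"; "It is not difficult to show that the length is of order `1/δ²`" [cite: DuminilCopinKozmaYadin2014, §4 (Problem 9)]), in the finite-volume form (Θ) `∀ ρ > 0 ∃ x > x_c: δ² E_{(𝔻_δ,a_δ,b_δ,x)}|γ_δ| ≤ ρ` for all small `δ`, is equivalent to (F) `∀ ε > 0 ∃ x > x_c: δ² (log Z_δ(x) - log Z_δ(x_c)) ≤ ε log(x/x_c)` for all small `δ` (`SupercriticalSAW.densityRightContinuous_of_flat`, `SupercriticalSAW.flat_of_densityRightContinuous`) and to (LD) `∀ ρ > 0 ∃ c > 0: P_{(𝔻_δ,a_δ,b_δ,x_c)}[δ²|γ_δ| ≥ ρ] ≤ e^{-c/δ²}` for all small `δ` (`SupercriticalSAW.expRare_of_flat`, `SupercriticalSAW.flat_of_expRare`), and implies ZERO CRITICAL DENSITY, `δ² E_{x_c}|γ_δ| → 0`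 and `P_{x_c}[δ²|γ_δ| ≥ ρ] → 0` for every `ρ > 0` (`SupercriticalSAW.tendsto_sq_mul_meanLength_criticalFugacity`, `SupercriticalSAW.tendsto_lawAt_density_of_tendsto_meanLength`) — a statement about the critical phase ("Another challenge is to try to say something nontrivial about the critical phase" [cite: DuminilCopinKozmaYadin2014, §4 (Problem 10)]) which is necessary for `Literature.Probability.RandomPlanarGeometry.SAW.SAWScalingLimit` in the disc (a limit in law, in the curve topology, carried by curves of zero area forces `|γ_δ| δ² → 0` in probability: the `δ`-squares around the visited sites are disjoint and lie in the `δ`-neighbourhood of the trace, and the SLE_{8/3} trace has zero area by the one-point estimate [cite: RohdeSchramm2005, Thm 8.1]; PROVED, for every Dobrushin domain, in the part-B companion `SupercriticalSAWSpaceFillingDensityNecessary`: `SupercriticalSAW.tendsto_law_density_of_sawScalingLimit`, unit-disc form `SupercriticalSAW.tendsto_lawAt_density_unitDisc_of_sawScalingLimit`) and logically independent of Problem 10 (weak space-filling needs only `≍ δ⁻¹/ε` sites; positive density does not fill every open set)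
- because: `log Z_δ(e^s)` is convex in `s` with derivative the mean length, so (Jensen under `P_x`, `SupercriticalSAW.meanLength_mul_log_le`) `E_x|γ| log(y/x) ≤ log Z(y) - log Z(x)` for all `x, y > 0`, and the mean length is nondecreasing in `x` (monotone likelihood ratio of `x^{|γ|}` in `|γ|`, `SupercriticalSAW.meanLength_mono`, cf. `SupercriticalSAW.lawAt_setOf_lt_length_mono`); the rest is Markov (`SupercriticalSAW.lawAt_density_le`), Chebyshev on the moment generating function (`SupercriticalSAW.lawAt_setOf_le_length_le_Zfin_div`) and its split at a density threshold with the maximal length `|γ_δ| ≤ |𝔻_δ| ≤ 25/δ²` (`SupercriticalSAW.Zfin_mul_le`, `SupercriticalSAW.length_le_div_sq`) [cite: DuminilCopinKozmaYadin2014, §1 (definition of P_{(Ω_δ,a_δ,b_δ,x)})]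
- evasions_known: this IS evasion (xiv) of the parent entry — the "from the supercritical side, as `x ↓ x_c`" twin of the left-uniform route (xii) of `SupercriticalSAWSpaceFillingLeftRobust`; in the square-crossing geometry the free energy `𝓗(z) = lim n⁻² log ς_n(z)` exists for all `z` [cite: Jansevanrensburg2015, Thm 5.74], vanishes for `z ≤ 1/μ` and is positive for `z > 1/μ` [cite: Jansevanrensburg2015, Thm 5.77 and Cor. 5.78] [cite: Madras1995] [cite: WhittingtonGuttmann1990], and `𝓗(e^s)` is convex, so there (F) reads `𝓗'(z_c⁺) = 0` — continuity of the dilute/dense transition, expected (heuristically, hyperscaling with `ν = 3/4` [cite: LawlerSchrammWerner2004SAW, Prediction 2]) with `𝓗 ≍ (z - z_c)^{3/2}`, but unproved: the only rigorous upper bound near `z_c` is the linear one from `|γ| ≤ |Ω_δ|`; (LD) is implied by the exponential rarity of positive-density confinement of free self-avoiding walks (`I(ρ) > 0` for every `ρ > 0`), a counting exercise at densities close to the maximal one (2-factor / permanent bounds) and open as `ρ → 0`, in the spirit of the missing lower bounds on the displacement exponent [cite: MadrasSlade1993, §1.1 (p. 6: "it is still an open question to prove that … ⟨|ω(N)|²⟩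 ≥ CN")] (sub-ballisticity being the known upper side [cite: DuminilCopinHammond2013]); so the axis relocates the difficulty of the critical phase into a counting problem about dense polymers near `x_c` rather than removing it
- scope_caveats: unit disc, arbitrary endpoints in `𝔻_δ` (closest sites included); the transfer gives UPPER bounds at `x_c` from the right (and, trivially, lower bounds from the left) — it cannot identify the critical law, only bound its density; the converse "(zero critical density) ⇒ (Θ)" is NOT claimed (a first-order dilute/dense coexistence at `x_c` resolved in favour of the dilute phase in finite volume would have zero critical density and `θ(x_c⁺) > 0`); the necessity of zero density for `SAWScalingLimit` is proved in the part-B companion `SupercriticalSAWSpaceFillingDensityNecessary` (every Dobrushin domain), while the link with the confinement entropy of free walks is recorded in prose only; fugacities `x ≤ 0` are junk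
- status: established (all clauses proved here: `SupercriticalSAWSpaceFillingDensity_holds`, axioms `propext`, `Classical.choice`, `Quot.sound`); audit gen 10 of `…Proofs` 2026-08-16: parent barrier CONFIRMED at page level [cite: DuminilCopinKozmaYadin2014, Theorem 1] [cite: DuminilCopinKozmaYadin2014, §4 (Problem 9)] and NARROWED on the density / free-energy axis

[cite: DuminilCopinKozmaYadin2014, §4 (Problem 9)] -/
def SupercriticalSAWSpaceFillingDensity : Prop :=
  ∀ A B : ℝ → Site 2,
    (∀ δ : ℝ, 0 < δ → A δ ∈ meshDomain unitDisk δ ∧ B δ ∈ meshDomain unitDisk δ) →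
    -- (1) transfer at fixed mesh
    (∀ x δ : ℝ, criticalFugacity < x → 0 < δ →
        meanLength criticalFugacity δ (A δ) (B δ) ≤ meanLength x δ (A δ) (B δ) ∧
        meanLength criticalFugacity δ (A δ) (B δ) * Real.log (x / criticalFugacity)
          ≤ Real.log (Zfin x δ (A δ) (B δ)) - Real.log (Zfin criticalFugacity δ (A δ) (B δ)) ∧
        Real.log (Zfin x δ (A δ) (B δ)) - Real.log (Zfin criticalFugacity δ (A δ) (B δ))
          ≤ meanLength x δ (A δ) (B δ) * Real.log (x / criticalFugacity)) ∧
    -- (2) (Θ) ↔ (F)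
    ((∀ ρ : ℝ, 0 < ρ → ∃ x : ℝ, criticalFugacity < x ∧ ∀ᶠ δ in 𝓝[>] (0 : ℝ),
        δ ^ 2 * meanLength x δ (A δ) (B δ) ≤ ρ) ↔
     (∀ ε : ℝ, 0 < ε → ∃ x : ℝ, criticalFugacity < x ∧ ∀ᶠ δ in 𝓝[>] (0 : ℝ),
        δ ^ 2 * (Real.log (Zfin x δ (A δ) (B δ)) - Real.log (Zfin criticalFugacity δ (A δ) (B δ)))
          ≤ ε * Real.log (x / criticalFugacity))) ∧
    -- (3) (F) ↔ (LD)
    ((∀ ε : ℝ, 0 < ε → ∃ x : ℝ, criticalFugacity < x ∧ ∀ᶠ δ in 𝓝[>] (0 : ℝ),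
        δ ^ 2 * (Real.log (Zfin x δ (A δ) (B δ)) - Real.log (Zfin criticalFugacity δ (A δ) (B δ)))
          ≤ ε * Real.log (x / criticalFugacity)) ↔
     (∀ ρ : ℝ, 0 < ρ → ∃ c : ℝ, 0 < c ∧ ∀ᶠ δ in 𝓝[>] (0 : ℝ),
        lawAt criticalFugacity unitDisk δ (A δ) (B δ) {γ | ρ ≤ δ ^ 2 * γ.length}
          ≤ ENNReal.ofReal (Real.exp (-(c / δ ^ 2))))) ∧
    -- (4) (Θ) → zero critical density, in expectation and in probability
    ((∀ ρ : ℝ, 0 < ρ → ∃ x : ℝ, criticalFugacity < x ∧ ∀ᶠ δ in 𝓝[>] (0 : ℝ),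
        δ ^ 2 * meanLength x δ (A δ) (B δ) ≤ ρ) →
      Tendsto (fun δ : ℝ => δ ^ 2 * meanLength criticalFugacity δ (A δ) (B δ)) (𝓝[>] 0) (𝓝 0) ∧
      ∀ ρ : ℝ, 0 < ρ → Tendsto (fun δ : ℝ => lawAt criticalFugacity unitDisk δ (A δ) (B δ)
        {γ | ρ ≤ δ ^ 2 * γ.length}) (𝓝[>] 0) (𝓝 0))

/-- The narrowed barrier holds (every clause is proved above). [cite: DuminilCopinKozmaYadin2014, §4 (Problem 9)] -/
theorem SupercriticalSAWSpaceFillingDensity_holds : SupercriticalSAWSpaceFillingDensity := by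
  intro A B hAB
  have hA : ∀ δ : ℝ, 0 < δ → A δ ∈ meshDomain unitDisk δ := fun δ hδ => (hAB δ hδ).1
  have hB : ∀ δ : ℝ, 0 < δ → B δ ∈ meshDomain unitDisk δ := fun δ hδ => (hAB δ hδ).2
  refine ⟨fun x δ hx hδ => ⟨meanLength_criticalFugacity_le hδ (hA δ hδ) (hB δ hδ) hx.le,
    log_Zfin_sub_log_Zfin_mem hδ (hA δ hδ) (hB δ hδ) hx⟩, ?_, ?_, ?_⟩
  · exact ⟨fun hΘ ε hε => flat_of_densityRightContinuous hA hB hΘ hε,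
      fun hF ρ hρ => densityRightContinuous_of_flat hA hB hF hρ⟩
  · exact ⟨fun hF ρ hρ => expRare_of_flat hA hB hF hρ,
      fun hLD ε hε => flat_of_expRare hA hB hLD hε⟩
  · intro hΘ
    have hZ := tendsto_sq_mul_meanLength_criticalFugacity hA hB hΘ
    exact ⟨hZ, fun ρ hρ => tendsto_lawAt_density_of_tendsto_meanLength hA hB hZ hρ⟩

end Literature.Barriers.CriticalPhenomena
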